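import Literature.Analysis.FunctionSpaces.PVHerbrandTools
import HarnessLib

/-!
# Strict `Σᵇ₁` / `Πᵇ₁` forms in Herbrand-saturated models of the true universal theory of `(ℕ, PV)`

Continuation of `PVHerbrandTools.lean`; the analogue for `S₂¹` / `PV` of
`Literature/Computability/MetaComplexity/BoundedArithUnivStrict.lean` (which treats `T₂ᵏ⁺¹`).
In a model `K ⊨ trueUnivPV` (both languages, `boundedArithToPV` an expansion):

* **sharply bounded formulas are open** (`hasOpenForm_of_isSharplyBounded`): every sharply
  bounded formula `θ(x̄)` of Buss's language is equivalent, in *every* model of `trueUnivPV`, to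
  an open `L(PV)`-formula — sharply bounded quantifiers are eliminated by the search symbol
  `lsearch` applied to the characteristic symbol of the matrix (Buss 1986, Ch. 6: sharply bounded
  formulas are `PV`-open; Krajíček 1995, §5.3);
* **strict forms** (`HasSigmaForm`, `HasPiForm`, `hasForms_of_isSigmab_of_isPib`): every `Σᵇ₁`
  formula `θ(x̄)` has a *strict* form `∃ w ≤ T(x̄) ψ(x̄, w)` with `T` a term of Buss's language and
  `ψ` open in `L(PV)`, *sound* in every model of `trueUnivPV` (`ψ(x̄, w) ∧ w ≤ T → θ`) and
  *complete* in every Herbrand-saturated one (`θ → ∃ w ≤ T ψ`); dually for `Πᵇ₁`.  The cases: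
  open / sharply bounded (dummy witness), `Πᵇ₁ → Σᵇ₁` (sum of the bounds), `∃ y ≤ t` and `∀ y ≤ t`
  (pairing `y + w · (1 # t)`), and the sharply bounded quantifiers `∀ i ≤ |s|` over `Σᵇ₁` resp.
  `∃ i ≤ |s|` over `Πᵇ₁`, where sharply bounded collection is provided by Herbrand saturation
  through the table symbol (`exists_table`) — Buss 1986, §2.7 (strict `Σᵇ₁`, `BB Σᵇ₁`);
  Krajíček 1995, proof of Thm. 7.6.3 ("every `Σᵇᵢ`-formula is equivalent to a `Σᵇ₁(PVᵢ)`-formula").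

The strict form of a `Σᵇ₁` formula is what is witnessed: in `PVHerbrandPIND.lean` it yields
`Σᵇ₁-PIND` in Herbrand-saturated models, and in `BussWitnessingPV.lean` the `PV` symbol
witnessing a `Σᵇ₁`-definable function.

## References

* S. R. Buss, *Bounded Arithmetic*, Bibliopolis 1986, §2.7, Ch. 5–6.
* J. Krajíček, *Bounded Arithmetic, Propositional Logic and Complexity Theory*, CUP 1995, §5.3,
  Thm. 7.6.3.
* J. Avigad, *Saturated models of universal theories*, APAL 118 (2002), §4.
-/

namespace Literature.Analysis.FunctionSpaces

open FirstOrder FirstOrder.Language FirstOrder.Language.BoundedFormula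
open Literature.Computability.MetaComplexity Literature.Computability.MetaComplexity.BASICModel
open Literature.ModelTheory.UniversalTheories

/-! ## Predicates uniform in the model; lifting terms into larger contexts -/

section Uniform

variable {n : ℕ}

/-- A predicate on `n`-tuples in every structure for both languages (the shape of
"`θ(x̄)` holds", uniformly in the model). [folklore] -/
def ModelPred (n : ℕ) : Type 1 :=
  ∀ (K : Type) [Language.boundedArith.Structure K] [Language.pv.Structure K], (Fin n → K) → Prop

/-- The predicate defined by a formula of Buss's language in context variables. [folklore] -/
def predOf (θ : Language.boundedArith.BoundedFormula Empty n) : ModelPred n :=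
  fun K _ _ xs => θ.Realize (default : Empty → K) xs

/-- `P` holds of all tuples in all models of `trueUnivPV` (compatible structures). [folklore] -/
def InModels (P : ModelPred n) : Prop :=
  ∀ (K : Type) [Language.boundedArith.Structure K] [Language.pv.Structure K]
    [boundedArithToPV.IsExpansionOn K], K ⊨ trueUnivPV → ∀ xs : Fin n → K, P K xs

/-- `P` holds of all tuples in all *Herbrand-saturated* models of `trueUnivPV`. [folklore] -/
def InSatModels (P : ModelPred n) : Prop :=
  ∀ (K : Type) [Language.boundedArith.Structure K] [Language.pv.Structure K]
    [boundedArithToPV.IsExpansionOn K], K ⊨ trueUnivPV → IsHerbrandSaturated Language.pv K →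
      ∀ xs : Fin n → K, P K xs

/-- What holds in all models holds in the saturated ones. [folklore] -/
theorem InModels.inSatModels {P : ModelPred n} (h : InModels P) : InSatModels P :=
  fun K _ _ _ hK _ xs => h K hK xs

/-- A term of Buss's language lifted from the context `x̄` to the context `(x̄, w)`. [folklore] -/
def upT (T : Language.boundedArith.Term (Empty ⊕ Fin n)) : Language.pv.Term (Empty ⊕ Fin (n + 1)) :=
  ιt (T.relabel (Sum.map id Fin.castSucc))

/-- A term of Buss's language lifted from `x̄` to `(x̄, a, b)`. [folklore] -/
def upT2 (T : Language.boundedArith.Term (Empty ⊕ Fin n)) : Language.pv.Term (Empty ⊕ Fin (n + 2)) :=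
  ιt (T.relabel (Sum.map id (Fin.castSucc ∘ Fin.castSucc)))

/-- A term in context `(x̄, y)` lifted to `(x̄, W, y)` (a new variable inserted before the last).
[folklore] -/
def upSkip (T : Language.boundedArith.Term (Empty ⊕ Fin (n + 1))) :
    Language.pv.Term (Empty ⊕ Fin (n + 2)) :=
  ιt (T.relabel (Sum.map id (Fin.snoc (fun j : Fin n => Fin.castSucc (Fin.castSucc j)) (Fin.last (n + 1)))))

/-- Substituting a term of Buss's language for the last context variable of a term of Buss's
language: `T[t/y]`. [folklore] -/
def substLastT (T : Language.boundedArith.Term (Empty ⊕ Fin (n + 1)))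
    (t : Language.boundedArith.Term (Empty ⊕ Fin n)) : Language.boundedArith.Term (Empty ⊕ Fin n) :=
  T.subst (Sum.elim (fun e => Term.var (Sum.inl e)) (Fin.snoc (fun i => Term.var (Sum.inr i)) t))

/-- Substituting an `L(PV)`-term (context `(x̄, p)`) for the last variable of a term of Buss's
language in context `(x̄, y)`: `T(x̄, f(x̄, p))`. [folklore] -/
def substLastPV (T : Language.boundedArith.Term (Empty ⊕ Fin (n + 1)))
    (f : Language.pv.Term (Empty ⊕ Fin (n + 1))) : Language.pv.Term (Empty ⊕ Fin (n + 1)) :=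
  (ιt T).subst (Sum.elim (fun e => Term.var (Sum.inl e)) (Fin.snoc (fun i => cv (Fin.castSucc i)) f))

variable {K : Type} [Language.boundedArith.Structure K] [Language.pv.Structure K]
  [boundedArithToPV.IsExpansionOn K]

/-- Semantics of `upT`. [folklore] -/
@[simp] theorem realize_upT (T : Language.boundedArith.Term (Empty ⊕ Fin n)) (xs : Fin n → K) (w : K) :
    (upT T).realize (Sum.elim default (Fin.snoc xs w)) = T.realize (Sum.elim default xs) := by
  rw [upT, realize_ιt, Term.realize_relabel, Sum.elim_comp_map, Function.comp_id]
  congr 1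
  funext a; rcases a with a | j
  · exact a.elim
  · simp

/-- Semantics of `upT2`. [folklore] -/
@[simp] theorem realize_upT2 (T : Language.boundedArith.Term (Empty ⊕ Fin n)) (xs : Fin n → K)
    (a b : K) :
    (upT2 T).realize (Sum.elim default (Fin.snoc (Fin.snoc xs a) b)) = T.realize (Sum.elim default xs) := by
  rw [upT2, realize_ιt, Term.realize_relabel, Sum.elim_comp_map, Function.comp_id]
  congr 1
  funext c; rcases c with c | j
  · exact c.elim
  · simp

/-- Semantics of `upSkip`. [folklore] -/
@[simp] theorem realize_upSkip (T : Language.boundedArith.Term (Empty ⊕ Fin (n + 1))) (xs : Fin n → K)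
    (W i : K) :
    (upSkip T).realize (Sum.elim default (Fin.snoc (Fin.snoc xs W) i)) =
      T.realize (Sum.elim default (Fin.snoc xs i)) := by
  rw [upSkip, realize_ιt, Term.realize_relabel, Sum.elim_comp_map, Function.comp_id]
  congr 1
  funext c; rcases c with c | j
  · exact c.elim
  · simp only [Function.comp_apply, Sum.elim_inr]
    cases j using Fin.lastCases with
    | last => simp
    | cast j => simp

omit [Language.pv.Structure K] [boundedArithToPV.IsExpansionOn K] in
/-- Semantics of `substLastT`. [folklore] -/
@[simp] theorem realize_substLastT (T : Language.boundedArith.Term (Empty ⊕ Fin (n + 1)))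
    (t : Language.boundedArith.Term (Empty ⊕ Fin n)) (xs : Fin n → K) :
    (substLastT T t).realize (Sum.elim default xs) =
      T.realize (Sum.elim default (Fin.snoc xs (t.realize (Sum.elim default xs)))) := by
  rw [substLastT, Term.realize_subst]
  congr 1
  funext c; rcases c with c | j
  · exact c.elim
  · simp only [Sum.elim_inr]
    cases j using Fin.lastCases with
    | last => simp
    | cast j => simp

/-- Semantics of `substLastPV`. [folklore] -/
@[simp] theorem realize_substLastPV (T : Language.boundedArith.Term (Empty ⊕ Fin (n + 1)))
    (f : Language.pv.Term (Empty ⊕ Fin (n + 1))) (xs : Fin n → K) (p : K) :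
    (substLastPV T f).realize (Sum.elim default (Fin.snoc xs p)) =
      T.realize (Sum.elim default (Fin.snoc xs (f.realize (Sum.elim default (Fin.snoc xs p))))) := by
  rw [substLastPV, Term.realize_subst, realize_ιt]
  congr 1
  funext c; rcases c with c | j
  · exact c.elim
  · simp only [Sum.elim_inr]
    cases j using Fin.lastCases with
    | last => simp
    | cast j => simp

omit [Language.boundedArith.Structure K] [boundedArithToPV.IsExpansionOn K] in
/-- Semantics of the context `(x̄, f(x̄, p))` as terms in `(x̄, p)`. [folklore] -/
theorem realize_snocCtx (f : Language.pv.Term (Empty ⊕ Fin (n + 1))) (xs : Fin n → K) (p : K) :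
    (fun i => Term.realize (Sum.elim default (Fin.snoc xs p))
      ((Fin.snoc (fun i : Fin n => (cv (Fin.castSucc i) : Language.pv.Term (Empty ⊕ Fin (n + 1)))) f :
        Fin (n + 1) → Language.pv.Term (Empty ⊕ Fin (n + 1))) i)) =
      Fin.snoc xs (f.realize (Sum.elim default (Fin.snoc xs p))) := by
  funext i
  cases i using Fin.lastCases with
  | last => simp
  | cast i => simp

end Uniform

/-! ## Sharply bounded formulas are open -/

section Open

variable {n : ℕ}

/-- **Uniform open form**: an open `L(PV)`-formula `π` equivalent to the predicate `A` in every
model of `trueUnivPV`. [folklore] -/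
def HasOpenForm (A : ModelPred n) : Prop :=
  ∃ π : Language.pv.BoundedFormula Empty n, π.IsQF ∧
    InModels fun K _ _ xs => A K xs ↔ π.Realize (default : Empty → K) xs

/-- Transport of open forms along uniform equivalence. [folklore] -/
theorem HasOpenForm.of_iff {A B : ModelPred n} (h : HasOpenForm A)
    (hAB : InModels fun K _ _ xs => A K xs ↔ B K xs) : HasOpenForm B := by
  obtain ⟨π, hπ, e⟩ := h
  exact ⟨π, hπ, fun K _ _ _ hK xs => (hAB K hK xs).symm.trans (e K hK xs)⟩

/-- Open formulas of Buss's language are open in `L(PV)` (through the language map). [folklore] -/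
theorem hasOpenForm_of_isQF {θ : Language.boundedArith.BoundedFormula Empty n} (hθ : θ.IsQF) :
    HasOpenForm (predOf θ) :=
  ⟨boundedArithToPV.onBoundedFormula θ, hθ.onBoundedFormula _, fun K _ _ _ _ _ =>
    (LHom.realize_onBoundedFormula (M := K) boundedArithToPV θ).symm⟩

/-- Open forms are closed under implication. [folklore] -/
theorem HasOpenForm.imp {A B : ModelPred n} (hA : HasOpenForm A) (hB : HasOpenForm B) :
    HasOpenForm fun K _ _ xs => A K xs → B K xs := by
  obtain ⟨π₁, hπ₁, e₁⟩ := hA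
  obtain ⟨π₂, hπ₂, e₂⟩ := hB
  exact ⟨π₁.imp π₂, hπ₁.imp hπ₂, fun K _ _ _ hK xs =>
    (imp_congr (e₁ K hK xs) (e₂ K hK xs)).trans realize_imp.symm⟩

/-- Open forms are closed under negation. [folklore] -/
theorem HasOpenForm.not {A : ModelPred n} (hA : HasOpenForm A) :
    HasOpenForm fun K _ _ xs => ¬ A K xs := by
  obtain ⟨π, hπ, e⟩ := hA
  exact ⟨∼π, hπ.not, fun K _ _ _ hK xs => (not_congr (e K hK xs)).trans realize_not.symm⟩

variable {K : Type} [Language.boundedArith.Structure K] [Language.pv.Structure K]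
  [boundedArithToPV.IsExpansionOn K]

/-- The characteristic symbol of a formula in context variables. [folklore] -/
def charSym {m : ℕ} (π : Language.pv.BoundedFormula Empty m) : PVFun m :=
  termSym ((charTerm π).relabel (Sum.elim Empty.elim id))

/-- **Fact (characteristic symbols).** For open `π`: `charSym π (x̄) = 1 ↔ π(x̄)` and
`charSym π (x̄) ∈ {0, 1}` in `K`. [cite: Krajicek1995, §5.3] -/
theorem papp_charSym [K ⊨ BASIC] (hK : K ⊨ trueUnivPV) {m : ℕ} {π : Language.pv.BoundedFormula Empty m}
    (hπ : π.IsQF) (xs : Fin m → K) :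
    (papp (charSym π) xs = 1 ↔ π.Realize default xs) ∧
      (papp (charSym π) xs = 0 ∨ papp (charSym π) xs = 1) := by
  have h := realize_charTerm hK hπ (default : Empty → K) xs
  have e : papp (charSym π) xs = (charTerm π).realize (Sum.elim default xs) := by
    rw [charSym, papp_termSym hK, Term.realize_relabel]
    congr 1
    funext a; rcases a with a | j
    · exact a.elim
    · rfl
  rw [e]
  exact h

/-- **A sharply bounded universal quantifier over an open form is open.** [cite: Buss1986, Ch. 6] -/
theorem HasOpenForm.ballLELen (t : Language.boundedArith.Term (Empty ⊕ Fin n)) {A : ModelPred (n + 1)}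
    (hA : HasOpenForm A) :
    HasOpenForm fun K _ _ xs => ∀ a : K, MLe a (mLen (t.realize (Sum.elim default xs))) →
      A K (Fin.snoc xs a) := by
  obtain ⟨π₁, hπ₁, e₁⟩ := hA
  let G : PVFun (n + 1) := charSym π₁
  let lsT : Language.pv.Term (Empty ⊕ Fin n) :=
    Term.func (PVFun.lsearch G) (Fin.snoc (fun i => cv i) (ιt t))
  let π : Language.pv.BoundedFormula Empty n := Term.bdEqual lsT (ιt (Term.succ (Term.len t)))
  refine ⟨π, (IsAtomic.equal _ _).isQF, fun K _ _ _ hK xs => ?_⟩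
  dsimp only
  haveI : K ⊨ BASIC := model_BASIC_of_trueUnivPV hK
  set u : K := t.realize (Sum.elim default xs) with hu
  have h01 : ∀ z : K, papp G (Fin.snoc xs z) = 0 ∨ papp G (Fin.snoc xs z) = 1 :=
    fun z => (papp_charSym hK hπ₁ (Fin.snoc xs z)).2
  have hsem : π.Realize (default : Empty → K) xs ↔ papp (PVFun.lsearch G) (Fin.snoc xs u) = mLen u + 1 := by
    simp only [π, lsT, realize_bdEqual, Term.realize, QSym.realize_snoc_terms, Sum.elim_inr, realize_ιt,
      realize_term_succ, realize_term_len, mSucc_eq, hu]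
  rw [hsem, ← forall_le_len_iff hK G xs u h01]
  exact forall_congr' fun a =>
    imp_congr (mLe_iff _ _) ((e₁ K hK (Fin.snoc xs a)).trans (papp_charSym hK hπ₁ (Fin.snoc xs a)).1.symm)

/-- **Sharply bounded formulas have open forms.** [cite: Buss1986, Ch. 6] -/
theorem hasOpenForm_of_isSharplyBounded {θ : Language.boundedArith.BoundedFormula Empty n}
    (h : IsSharplyBounded θ) : HasOpenForm (predOf θ) := by
  induction h with
  | of_isQF h => exact hasOpenForm_of_isQF h
  | imp _ _ ih₁ ih₂ =>
    exact (ih₁.imp ih₂).of_iff fun K _ _ _ hK xs => by simp [predOf]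
  | ballLELen t _ ih =>
    refine (ih.ballLELen t).of_iff fun K _ _ _ hK xs => ?_
    simp only [predOf, ballLELen, realize_ballLE', realize_term_len]
  | bexLELen t _ ih =>
    refine (ih.not.ballLELen t).not.of_iff fun K _ _ _ hK xs => ?_
    simp only [predOf, bexLELen, realize_bexLE', realize_term_len]
    push Not
    rfl

end Open

/-! ## Strict forms -/

section Strict

variable {n : ℕ}

/-- **Strict `Σ` form** of a predicate, uniformly in the model: an open `ψ(x̄, w)` of `L(PV)` and a
term `T(x̄)` of Buss's language with `w ≤ T(x̄) ∧ ψ(x̄, w) → A(x̄)` in every model of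
`trueUnivPV` (*soundness*) and `A(x̄) → ∃ w ≤ T(x̄) ψ(x̄, w)` in every Herbrand-saturated one
(*completeness*) (Buss 1986, §2.7: strict `Σᵇ₁` formulas; Krajíček 1995, proof of Thm. 7.6.3).
[cite: Buss1986, §2.7] -/
def HasSigmaForm (A : ModelPred n) : Prop :=
  ∃ (ψ : Language.pv.BoundedFormula Empty (n + 1)) (T : Language.boundedArith.Term (Empty ⊕ Fin n)),
    ψ.IsQF ∧
    InModels (fun K _ _ xs => ∀ w : K, MLe w (T.realize (Sum.elim default xs)) →
      ψ.Realize (default : Empty → K) (Fin.snoc xs w) → A K xs) ∧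
    InSatModels (fun K _ _ xs => A K xs → ∃ w : K, MLe w (T.realize (Sum.elim default xs)) ∧
      ψ.Realize (default : Empty → K) (Fin.snoc xs w))

/-- **Strict `Π` form**: `A(x̄) → ∀ w ≤ T(x̄) ψ(x̄, w)` in every model, and
`(∀ w ≤ T(x̄) ψ(x̄, w)) → A(x̄)` in every Herbrand-saturated one. [cite: Buss1986, §2.7] -/
def HasPiForm (A : ModelPred n) : Prop :=
  ∃ (ψ : Language.pv.BoundedFormula Empty (n + 1)) (T : Language.boundedArith.Term (Empty ⊕ Fin n)),
    ψ.IsQF ∧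
    InModels (fun K _ _ xs => A K xs → ∀ w : K, MLe w (T.realize (Sum.elim default xs)) →
      ψ.Realize (default : Empty → K) (Fin.snoc xs w)) ∧
    InSatModels (fun K _ _ xs => (∀ w : K, MLe w (T.realize (Sum.elim default xs)) →
      ψ.Realize (default : Empty → K) (Fin.snoc xs w)) → A K xs)

/-- Transport of `Σ` forms along uniform equivalence. [folklore] -/
theorem HasSigmaForm.of_iff {A B : ModelPred n} (h : HasSigmaForm A)
    (hAB : InModels fun K _ _ xs => A K xs ↔ B K xs) : HasSigmaForm B := by
  obtain ⟨ψ, T, hψ, hs, hc⟩ := h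
  exact ⟨ψ, T, hψ, fun K _ _ _ hK xs w hw h => (hAB K hK xs).1 (hs K hK xs w hw h),
    fun K _ _ _ hK hsat xs hB => hc K hK hsat xs ((hAB K hK xs).2 hB)⟩

/-- Transport of `Π` forms along uniform equivalence. [folklore] -/
theorem HasPiForm.of_iff {A B : ModelPred n} (h : HasPiForm A)
    (hAB : InModels fun K _ _ xs => A K xs ↔ B K xs) : HasPiForm B := by
  obtain ⟨ψ, T, hψ, hs, hc⟩ := h
  exact ⟨ψ, T, hψ, fun K _ _ _ hK xs hB w hw => hs K hK xs ((hAB K hK xs).2 hB) w hw,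
    fun K _ _ _ hK hsat xs h => (hAB K hK xs).1 (hc K hK hsat xs h)⟩

/-- **An open predicate has a `Σ` form** (dummy witness `w ≤ 0`). [folklore] -/
theorem HasOpenForm.hasSigmaForm {A : ModelPred n} (h : HasOpenForm A) : HasSigmaForm A := by
  obtain ⟨π, hπ, e⟩ := h
  refine ⟨substCtx π fun i => cv (Fin.castSucc i), 0, isQF_substCtx hπ _,
    fun K _ _ _ hK xs w _ hw => ?_, fun K _ _ _ hK _ xs hA => ?_⟩
  · rw [realize_substCtx] at hw
    simp only [Term.realize, Sum.elim_inr, Fin.snoc_castSucc] at hw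
    exact (e K hK xs).2 hw
  · haveI : K ⊨ BASIC := model_BASIC_of_trueUnivPV hK
    refine ⟨0, by simp, ?_⟩
    rw [realize_substCtx]
    simp only [Term.realize, Sum.elim_inr, Fin.snoc_castSucc]
    exact (e K hK xs).1 hA

/-- **An open predicate has a `Π` form**. [folklore] -/
theorem HasOpenForm.hasPiForm {A : ModelPred n} (h : HasOpenForm A) : HasPiForm A := by
  obtain ⟨π, hπ, e⟩ := h
  refine ⟨substCtx π fun i => cv (Fin.castSucc i), 0, isQF_substCtx hπ _,
    fun K _ _ _ hK xs hA w _ => ?_, fun K _ _ _ hK _ xs h => ?_⟩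
  · rw [realize_substCtx]
    simp only [Term.realize, Sum.elim_inr, Fin.snoc_castSucc]
    exact (e K hK xs).1 hA
  · haveI : K ⊨ BASIC := model_BASIC_of_trueUnivPV hK
    have h0 := h 0 (by simp)
    rw [realize_substCtx] at h0
    simp only [Term.realize, Sum.elim_inr, Fin.snoc_castSucc] at h0
    exact (e K hK xs).2 h0

/-- **`Π → Σ` is `Σ`** (bound: the sum of the bounds). [cite: Buss1986, §2.7] -/
theorem HasPiForm.imp_sigma {A B : ModelPred n} (hA : HasPiForm A) (hB : HasSigmaForm B) :
    HasSigmaForm fun K _ _ xs => A K xs → B K xs := by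
  obtain ⟨ψ₁, T₁, hψ₁, s₁, c₁⟩ := hA
  obtain ⟨ψ₂, T₂, hψ₂, s₂, c₂⟩ := hB
  let w : Language.pv.Term (Empty ⊕ Fin (n + 1)) := cv (Fin.last n)
  let Ψ : Language.pv.BoundedFormula Empty (n + 1) :=
    (Term.le w (upT T₁) ⊓ ∼ψ₁) ⊔ (Term.le w (upT T₂) ⊓ ψ₂)
  have hΨ : Ψ.IsQF :=
    ((IsAtomic.rel _ _).isQF.inf hψ₁.not).sup ((IsAtomic.rel _ _).isQF.inf hψ₂)
  refine ⟨Ψ, T₁ + T₂, hΨ, fun K _ _ _ hK xs v _ hv hAx => ?_, fun K _ _ _ hK hsat xs hAB => ?_⟩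
  · haveI : K ⊨ BASIC := model_BASIC_of_trueUnivPV hK
    simp only [Ψ, w, realize_sup, realize_inf, realize_not, realize_pvle, Term.realize, Sum.elim_inr,
      Fin.snoc_last, realize_upT] at hv
    rcases hv with ⟨hv1, hnψ⟩ | ⟨hv2, hψ⟩
    · exact absurd (s₁ K hK xs hAx v ((mLe_iff _ _).2 hv1)) hnψ
    · exact s₂ K hK xs v ((mLe_iff _ _).2 hv2) hψ
  · haveI : K ⊨ BASIC := model_BASIC_of_trueUnivPV hK
    by_cases hAx : A K xs
    · obtain ⟨v, hv, hψ⟩ := c₂ K hK hsat xs (hAB hAx)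
      rw [mLe_iff] at hv
      refine ⟨v, ?_, ?_⟩
      · rw [mLe_iff, realize_term_add, mAdd_eq]; exact le_trans hv (le_add_left'' _ _)
      · simp only [Ψ, w, realize_sup, realize_inf, realize_not, realize_pvle, Term.realize, Sum.elim_inr,
          Fin.snoc_last, realize_upT]
        exact Or.inr ⟨hv, hψ⟩
    · have h : ¬ ∀ v : K, MLe v (T₁.realize (Sum.elim default xs)) → ψ₁.Realize default (Fin.snoc xs v) :=
        fun h => hAx (c₁ K hK hsat xs h)
      push Not at h
      obtain ⟨v, hv, hnψ⟩ := h
      rw [mLe_iff] at hv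
      refine ⟨v, ?_, ?_⟩
      · rw [mLe_iff, realize_term_add, mAdd_eq]; exact le_trans hv (le_add_right'' _ _)
      · simp only [Ψ, w, realize_sup, realize_inf, realize_not, realize_pvle, Term.realize, Sum.elim_inr,
          Fin.snoc_last, realize_upT]
        exact Or.inl ⟨hv, hnψ⟩

/-- The pairing bound `t + r · (1 # t)`. [folklore] -/
def pairBound (t r : Language.boundedArith.Term (Empty ⊕ Fin n)) : Language.boundedArith.Term (Empty ⊕ Fin n) :=
  t + r * Term.smash (natConst 1) t

variable {K : Type} [Language.boundedArith.Structure K] [Language.pv.Structure K]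
  [boundedArithToPV.IsExpansionOn K]

omit [Language.pv.Structure K] [boundedArithToPV.IsExpansionOn K] in
/-- Semantics of `pairBound`. [folklore] -/
@[simp] theorem realize_pairBound [K ⊨ BASIC] (t r : Language.boundedArith.Term (Empty ⊕ Fin n)) (xs : Fin n → K) :
    (pairBound t r).realize (Sum.elim default xs) =
      t.realize (Sum.elim default xs) + r.realize (Sum.elim default xs) * mSmash 1 (t.realize (Sum.elim default xs)) := by
  simp only [pairBound, realize_term_add, realize_term_mul, realize_term_smash, realize_natConst_one,
    mSucc_eq, mZero_eq, zero_add, mAdd_eq, mMul_eq]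

omit [Language.pv.Structure K] [boundedArithToPV.IsExpansionOn K] in
/-- A pair is below the pairing bound. [folklore] -/
theorem pair_le_pairBound [K ⊨ BASIC] {y w tv rv : K} (hy : y ≤ tv) (hw : w ≤ rv) :
    y + w * mSmash 1 tv ≤ tv + rv * mSmash 1 tv :=
  add_le_add hy (mul_le_mul'' hw le_rfl)

/-- The first component `lspLen (p, t)` of the pair `p` (last context variable). [folklore] -/
abbrev fstT (t : Language.boundedArith.Term (Empty ⊕ Fin n)) : Language.pv.Term (Empty ⊕ Fin (n + 1)) :=
  fn2 PVFun.lspLen (cv (Fin.last n)) (upT t)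

/-- The second component `mspLen (p, t)` of the pair `p`. [folklore] -/
abbrev sndT (t : Language.boundedArith.Term (Empty ⊕ Fin n)) : Language.pv.Term (Empty ⊕ Fin (n + 1)) :=
  fn2 PVFun.mspLen (cv (Fin.last n)) (upT t)

/-- The context `(x̄, fst p, snd p)` as terms in the context `(x̄, p)`. [folklore] -/
def pairCtx (t : Language.boundedArith.Term (Empty ⊕ Fin n)) :
    Fin (n + 2) → Language.pv.Term (Empty ⊕ Fin (n + 1)) :=
  Fin.snoc (Fin.snoc (fun i => cv (Fin.castSucc i)) (fstT t)) (sndT t)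

/-- Semantics of `pairCtx`. [folklore] -/
theorem realize_pairCtx (t : Language.boundedArith.Term (Empty ⊕ Fin n)) (xs : Fin n → K) (p : K) :
    (fun i => (pairCtx t i).realize (Sum.elim default (Fin.snoc xs p))) =
      Fin.snoc (Fin.snoc xs (papp PVFun.lspLen ![p, t.realize (Sum.elim default xs)]))
        (papp PVFun.mspLen ![p, t.realize (Sum.elim default xs)]) := by
  funext i
  simp only [pairCtx]
  cases i using Fin.lastCases with
  | last => simp
  | cast i =>
    cases i using Fin.lastCases with
    | last => simp
    | cast i => simp

/-- **`∃ y ≤ t` over `Σ` is `Σ`** (pairing). [cite: Buss1986, §2.7] -/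
theorem HasSigmaForm.bexLE (t : Language.boundedArith.Term (Empty ⊕ Fin n)) {A : ModelPred (n + 1)}
    (hA : HasSigmaForm A) :
    HasSigmaForm fun K _ _ xs => ∃ y : K, MLe y (t.realize (Sum.elim default xs)) ∧ A K (Fin.snoc xs y) := by
  obtain ⟨ψ₁, T₁, hψ₁, s₁, c₁⟩ := hA
  let Ψ : Language.pv.BoundedFormula Empty (n + 1) :=
    Term.le (fstT t) (upT t) ⊓ Term.le (sndT t) (substLastPV T₁ (fstT t)) ⊓ substCtx ψ₁ (pairCtx t)
  have hΨ : Ψ.IsQF := ((IsAtomic.rel _ _).isQF.inf (IsAtomic.rel _ _).isQF).inf (isQF_substCtx hψ₁ _)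
  refine ⟨Ψ, pairBound t (substLastT T₁ t), hΨ, fun K _ _ _ hK xs p _ hp => ?_,
    fun K _ _ _ hK hsat xs hex => ?_⟩
  · haveI : K ⊨ BASIC := model_BASIC_of_trueUnivPV hK
    simp only [Ψ, realize_inf, realize_pvle, funMap_vec2, Term.realize, Sum.elim_inr, Fin.snoc_last,
      realize_upT, realize_substLastPV, realize_substCtx, realize_pairCtx] at hp
    obtain ⟨⟨h1, h2⟩, h3⟩ := hp
    exact ⟨_, (mLe_iff _ _).2 h1, s₁ K hK (Fin.snoc xs _) _ ((mLe_iff _ _).2 h2) h3⟩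
  · haveI : K ⊨ BASIC := model_BASIC_of_trueUnivPV hK
    obtain ⟨y, hy, hAy⟩ := hex
    rw [mLe_iff] at hy
    obtain ⟨w, hw, hψ⟩ := c₁ K hK hsat (Fin.snoc xs y) hAy
    rw [mLe_iff] at hw
    set tv := t.realize (Sum.elim default xs) with htv
    obtain ⟨hd1, hd2⟩ := pair_decode hK hy w
    refine ⟨y + w * mSmash 1 tv, ?_, ?_⟩
    · rw [mLe_iff, realize_pairBound, realize_substLastT]
      refine pair_le_pairBound hy (le_trans hw (realize_mono hK T₁ fun a => ?_))
      rcases a with a | j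
      · exact a.elim
      · cases j using Fin.lastCases with
        | last => simpa using hy
        | cast j => simp
    · simp only [Ψ, realize_inf, realize_pvle, funMap_vec2, Term.realize, Sum.elim_inr, Fin.snoc_last,
        realize_upT, realize_substLastPV, realize_substCtx, realize_pairCtx, ← htv, hd1, hd2]
      exact ⟨⟨hy, hw⟩, hψ⟩

/-- **`∀ y ≤ t` over `Π` is `Π`** (pairing). [cite: Buss1986, §2.7] -/
theorem HasPiForm.ballLE (t : Language.boundedArith.Term (Empty ⊕ Fin n)) {A : ModelPred (n + 1)}
    (hA : HasPiForm A) :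
    HasPiForm fun K _ _ xs => ∀ y : K, MLe y (t.realize (Sum.elim default xs)) → A K (Fin.snoc xs y) := by
  obtain ⟨ψ₁, T₁, hψ₁, s₁, c₁⟩ := hA
  let Ψ : Language.pv.BoundedFormula Empty (n + 1) :=
    Term.le (fstT t) (upT t) ⟹ Term.le (sndT t) (substLastPV T₁ (fstT t)) ⟹ substCtx ψ₁ (pairCtx t)
  have hΨ : Ψ.IsQF := (IsAtomic.rel _ _).isQF.imp ((IsAtomic.rel _ _).isQF.imp (isQF_substCtx hψ₁ _))
  refine ⟨Ψ, pairBound t (substLastT T₁ t), hΨ, fun K _ _ _ hK xs hall p _ => ?_,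
    fun K _ _ _ hK hsat xs h y hy => ?_⟩
  · haveI : K ⊨ BASIC := model_BASIC_of_trueUnivPV hK
    simp only [Ψ, realize_imp, realize_pvle, funMap_vec2, Term.realize, Sum.elim_inr, Fin.snoc_last,
      realize_upT, realize_substLastPV, realize_substCtx, realize_pairCtx]
    intro h1 h2
    exact s₁ K hK (Fin.snoc xs _) (hall _ ((mLe_iff _ _).2 h1)) _ ((mLe_iff _ _).2 h2)
  · haveI : K ⊨ BASIC := model_BASIC_of_trueUnivPV hK
    rw [mLe_iff] at hy
    refine c₁ K hK hsat (Fin.snoc xs y) fun w hw => ?_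
    rw [mLe_iff] at hw
    set tv := t.realize (Sum.elim default xs) with htv
    obtain ⟨hd1, hd2⟩ := pair_decode hK hy w
    have hp := h (y + w * mSmash 1 tv) (by
      rw [mLe_iff, realize_pairBound, realize_substLastT]
      refine pair_le_pairBound hy (le_trans hw (realize_mono hK T₁ fun a => ?_))
      rcases a with a | j
      · exact a.elim
      · cases j using Fin.lastCases with
        | last => simpa using hy
        | cast j => simp)
    simp only [Ψ, realize_imp, realize_pvle, funMap_vec2, Term.realize, Sum.elim_inr, Fin.snoc_last,
      realize_upT, realize_substLastPV, realize_substCtx, realize_pairCtx, ← htv, hd1, hd2] at hp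
    exact hp hy hw

/-- **`Σ → Π` is `Π`** (pairing the two witnesses). [cite: Buss1986, §2.7] -/
theorem HasSigmaForm.imp_pi {A B : ModelPred n} (hA : HasSigmaForm A) (hB : HasPiForm B) :
    HasPiForm fun K _ _ xs => A K xs → B K xs := by
  obtain ⟨ψ₁, T₁, hψ₁, s₁, c₁⟩ := hA
  obtain ⟨ψ₂, T₂, hψ₂, s₂, c₂⟩ := hB
  let Ψ : Language.pv.BoundedFormula Empty (n + 1) :=
    Term.le (fstT T₁) (upT T₁) ⟹ Term.le (sndT T₁) (upT T₂) ⟹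
      substCtx ψ₁ (Fin.snoc (fun i => cv (Fin.castSucc i)) (fstT T₁)) ⟹
        substCtx ψ₂ (Fin.snoc (fun i => cv (Fin.castSucc i)) (sndT T₁))
  have hΨ : Ψ.IsQF := (IsAtomic.rel _ _).isQF.imp ((IsAtomic.rel _ _).isQF.imp
    ((isQF_substCtx hψ₁ _).imp (isQF_substCtx hψ₂ _)))
  refine ⟨Ψ, pairBound T₁ T₂, hΨ, fun K _ _ _ hK xs hAB p _ => ?_, fun K _ _ _ hK hsat xs h hAx => ?_⟩
  · haveI : K ⊨ BASIC := model_BASIC_of_trueUnivPV hK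
    simp only [Ψ, realize_imp, realize_pvle, funMap_vec2, Term.realize, Sum.elim_inr, Fin.snoc_last,
      realize_upT, realize_substCtx, realize_snocCtx]
    intro h1 h2 h3
    exact s₂ K hK xs (hAB (s₁ K hK xs _ ((mLe_iff _ _).2 h1) h3)) _ ((mLe_iff _ _).2 h2)
  · haveI : K ⊨ BASIC := model_BASIC_of_trueUnivPV hK
    obtain ⟨w₁, hw₁, hψ₁w⟩ := c₁ K hK hsat xs hAx
    rw [mLe_iff] at hw₁
    refine c₂ K hK hsat xs fun w₂ hw₂ => ?_
    rw [mLe_iff] at hw₂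
    set tv := T₁.realize (Sum.elim default xs) with htv
    obtain ⟨hd1, hd2⟩ := pair_decode hK hw₁ w₂
    have hp := h (w₁ + w₂ * mSmash 1 tv) (by
      rw [mLe_iff, realize_pairBound]; exact pair_le_pairBound hw₁ hw₂)
    simp only [Ψ, realize_imp, realize_pvle, funMap_vec2, Term.realize, Sum.elim_inr, Fin.snoc_last,
      realize_upT, realize_substCtx, realize_snocCtx, ← htv, hd1, hd2] at hp
    exact hp hw₁ hw₂ hψ₁w

/-! ### The sharply bounded quantifiers: collection -/

/-- The width bound `b = r(x̄, |s(x̄)|)` of the table of witnesses. [folklore] -/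
def tblB (s : Language.boundedArith.Term (Empty ⊕ Fin n)) (r : Language.boundedArith.Term (Empty ⊕ Fin (n + 1))) :
    Language.boundedArith.Term (Empty ⊕ Fin n) :=
  substLastT r (Term.len s)

/-- The width source `2 b + 1`. [folklore] -/
def tblC (s : Language.boundedArith.Term (Empty ⊕ Fin n)) (r : Language.boundedArith.Term (Empty ⊕ Fin (n + 1))) :
    Language.boundedArith.Term (Empty ⊕ Fin n) :=
  Term.succ (natConst 2 * tblB s r)

/-- The table bound `(2 s + 1) # (2 b + 1)`. [folklore] -/
def tblBound (s : Language.boundedArith.Term (Empty ⊕ Fin n)) (r : Language.boundedArith.Term (Empty ⊕ Fin (n + 1))) :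
    Language.boundedArith.Term (Empty ⊕ Fin n) :=
  Term.smash (Term.succ (natConst 2 * s)) (tblC s r)

/-- The digit term `entry (W, i, 2b+1)` in the context `(x̄, W, i)`. [folklore] -/
def entryT (s : Language.boundedArith.Term (Empty ⊕ Fin n)) (r : Language.boundedArith.Term (Empty ⊕ Fin (n + 1))) :
    Language.pv.Term (Empty ⊕ Fin (n + 2)) :=
  fn3 PVFun.entry (cv (Fin.castSucc (Fin.last n))) (cv (Fin.last (n + 1))) (upT2 (tblC s r))

/-- The matrix context `(x̄, i, entry (W, i, 2b+1))` as terms in `(x̄, W, i)`. [folklore] -/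
def entryCtx (s : Language.boundedArith.Term (Empty ⊕ Fin n)) (r : Language.boundedArith.Term (Empty ⊕ Fin (n + 1))) :
    Fin (n + 2) → Language.pv.Term (Empty ⊕ Fin (n + 2)) :=
  Fin.snoc (Fin.snoc (fun j => cv (Fin.castSucc (Fin.castSucc j))) (cv (Fin.last (n + 1)))) (entryT s r)

omit [Language.pv.Structure K] [boundedArithToPV.IsExpansionOn K] in
/-- Semantics of `tblB`. [folklore] -/
theorem realize_tblB (s : Language.boundedArith.Term (Empty ⊕ Fin n))
    (r : Language.boundedArith.Term (Empty ⊕ Fin (n + 1))) (xs : Fin n → K) :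
    (tblB s r).realize (Sum.elim default xs) =
      r.realize (Sum.elim default (Fin.snoc xs (mLen (s.realize (Sum.elim default xs))))) := by
  rw [tblB, realize_substLastT, realize_term_len]

omit [Language.pv.Structure K] [boundedArithToPV.IsExpansionOn K] in
/-- Semantics of `tblC`. [folklore] -/
theorem realize_tblC [K ⊨ BASIC] (s : Language.boundedArith.Term (Empty ⊕ Fin n))
    (r : Language.boundedArith.Term (Empty ⊕ Fin (n + 1))) (xs : Fin n → K) :
    (tblC s r).realize (Sum.elim default xs) =
      2 * r.realize (Sum.elim default (Fin.snoc xs (mLen (s.realize (Sum.elim default xs))))) + 1 := by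
  rw [tblC, realize_term_succ, realize_term_mul, realize_natConst_two', realize_tblB, mSucc_eq, mMul_eq]

omit [Language.pv.Structure K] [boundedArithToPV.IsExpansionOn K] in
/-- Semantics of `tblBound`. [folklore] -/
theorem realize_tblBound [K ⊨ BASIC] (s : Language.boundedArith.Term (Empty ⊕ Fin n))
    (r : Language.boundedArith.Term (Empty ⊕ Fin (n + 1))) (xs : Fin n → K) :
    (tblBound s r).realize (Sum.elim default xs) =
      mSmash (2 * s.realize (Sum.elim default xs) + 1)
        (2 * r.realize (Sum.elim default (Fin.snoc xs (mLen (s.realize (Sum.elim default xs))))) + 1) := by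
  rw [tblBound, realize_term_smash, realize_term_succ, realize_term_mul, realize_natConst_two', realize_tblC,
    mSucc_eq, mMul_eq]

/-- Semantics of `entryCtx`. [folklore] -/
theorem realize_entryCtx [K ⊨ BASIC] (s : Language.boundedArith.Term (Empty ⊕ Fin n))
    (r : Language.boundedArith.Term (Empty ⊕ Fin (n + 1))) (xs : Fin n → K) (W i : K) :
    (fun j => (entryCtx s r j).realize (Sum.elim default (Fin.snoc (Fin.snoc xs W) i))) =
      Fin.snoc (Fin.snoc xs i) (papp PVFun.entry ![W, i,
        2 * r.realize (Sum.elim default (Fin.snoc xs (mLen (s.realize (Sum.elim default xs))))) + 1]) := by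
  funext j
  simp only [entryCtx, entryT]
  cases j using Fin.lastCases with
  | last => simp [realize_tblC]
  | cast j =>
    cases j using Fin.lastCases with
    | last => simp
    | cast j => simp

/-- The open matrix `entry ≤ r(x̄, i) ∧ ψ(x̄, i, entry)` resp. `entry ≤ r(x̄, i) → ψ(x̄, i, entry)`
in the context `(x̄, W, i)`. [folklore] -/
def tblMatrix (conj : Bool) (ψ : Language.pv.BoundedFormula Empty (n + 2))
    (s : Language.boundedArith.Term (Empty ⊕ Fin n)) (r : Language.boundedArith.Term (Empty ⊕ Fin (n + 1))) :
    Language.pv.BoundedFormula Empty (n + 2) :=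
  if conj then Term.le (entryT s r) (upSkip r) ⊓ substCtx ψ (entryCtx s r)
  else Term.le (entryT s r) (upSkip r) ⟹ substCtx ψ (entryCtx s r)

omit [Language.boundedArith.Structure K] [Language.pv.Structure K] [boundedArithToPV.IsExpansionOn K] in
/-- The matrix is open. [folklore] -/
theorem isQF_tblMatrix (conj : Bool) {ψ : Language.pv.BoundedFormula Empty (n + 2)} (hψ : ψ.IsQF)
    (s : Language.boundedArith.Term (Empty ⊕ Fin n)) (r : Language.boundedArith.Term (Empty ⊕ Fin (n + 1))) :
    (tblMatrix conj ψ s r).IsQF := by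
  cases conj
  · exact (IsAtomic.rel _ _).isQF.imp (isQF_substCtx hψ _)
  · exact (IsAtomic.rel _ _).isQF.inf (isQF_substCtx hψ _)

/-- Semantics of the conjunctive matrix. [folklore] -/
theorem realize_tblMatrix_true [K ⊨ BASIC] (ψ : Language.pv.BoundedFormula Empty (n + 2))
    (s : Language.boundedArith.Term (Empty ⊕ Fin n)) (r : Language.boundedArith.Term (Empty ⊕ Fin (n + 1)))
    (xs : Fin n → K) (W i : K) :
    (tblMatrix true ψ s r).Realize default (Fin.snoc (Fin.snoc xs W) i) ↔
      papp PVFun.entry ![W, i, 2 * r.realize (Sum.elim default (Fin.snoc xs (mLen (s.realize (Sum.elim default xs))))) + 1]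
          ≤ r.realize (Sum.elim default (Fin.snoc xs i)) ∧
        ψ.Realize default (Fin.snoc (Fin.snoc xs i) (papp PVFun.entry ![W, i,
          2 * r.realize (Sum.elim default (Fin.snoc xs (mLen (s.realize (Sum.elim default xs))))) + 1])) := by
  simp only [tblMatrix, if_true, realize_inf, realize_pvle, realize_substCtx, realize_entryCtx, realize_upSkip]
  simp only [entryT, realize_fn3, Term.realize, Sum.elim_inr, Fin.snoc_castSucc, Fin.snoc_last, realize_upT2,
    realize_tblC]

/-- Semantics of the implicational matrix. [folklore] -/
theorem realize_tblMatrix_false [K ⊨ BASIC] (ψ : Language.pv.BoundedFormula Empty (n + 2))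
    (s : Language.boundedArith.Term (Empty ⊕ Fin n)) (r : Language.boundedArith.Term (Empty ⊕ Fin (n + 1)))
    (xs : Fin n → K) (W i : K) :
    (tblMatrix false ψ s r).Realize default (Fin.snoc (Fin.snoc xs W) i) ↔
      (papp PVFun.entry ![W, i, 2 * r.realize (Sum.elim default (Fin.snoc xs (mLen (s.realize (Sum.elim default xs))))) + 1]
          ≤ r.realize (Sum.elim default (Fin.snoc xs i)) →
        ψ.Realize default (Fin.snoc (Fin.snoc xs i) (papp PVFun.entry ![W, i,
          2 * r.realize (Sum.elim default (Fin.snoc xs (mLen (s.realize (Sum.elim default xs))))) + 1]))) := by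
  simp only [tblMatrix, Bool.false_eq_true, if_false, realize_imp, realize_pvle, realize_substCtx,
    realize_entryCtx, realize_upSkip]
  simp only [entryT, realize_fn3, Term.realize, Sum.elim_inr, Fin.snoc_castSucc, Fin.snoc_last, realize_upT2,
    realize_tblC]

/-- The search formula `lsearch_G (x̄, W, s) = |s| + 1` in the context `(x̄, W)`. [folklore] -/
def searchEq (G : PVFun (n + 2)) (s : Language.boundedArith.Term (Empty ⊕ Fin n)) :
    Language.pv.BoundedFormula Empty (n + 1) :=
  Term.bdEqual (Term.func (PVFun.lsearch G) (Fin.snoc (fun j => cv j) (upT s)))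
    (upT (Term.succ (Term.len s)))

/-- Semantics of `searchEq`. [folklore] -/
theorem realize_searchEq [K ⊨ BASIC] (G : PVFun (n + 2)) (s : Language.boundedArith.Term (Empty ⊕ Fin n))
    (xs : Fin n → K) (W : K) :
    (searchEq G s).Realize default (Fin.snoc xs W) ↔
      papp (PVFun.lsearch G) (Fin.snoc (Fin.snoc xs W) (s.realize (Sum.elim default xs))) =
        mLen (s.realize (Sum.elim default xs)) + 1 := by
  simp only [searchEq, realize_bdEqual, Term.realize, QSym.realize_snoc_terms, Sum.elim_inr, realize_upT,
    realize_term_succ, realize_term_len, mSucc_eq]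

/-- **`∀ i ≤ |s|` over `Σ` is `Σ`**: the witnesses are collected in a table (sharply bounded
collection from Herbrand saturation). [cite: Buss1986, §2.7] -/
theorem HasSigmaForm.ballLELen (s : Language.boundedArith.Term (Empty ⊕ Fin n)) {A : ModelPred (n + 1)}
    (hA : HasSigmaForm A) :
    HasSigmaForm fun K _ _ xs => ∀ i : K, MLe i (mLen (s.realize (Sum.elim default xs))) → A K (Fin.snoc xs i) := by
  obtain ⟨ψ₁, T₁, hψ₁, s₁, c₁⟩ := hA
  let M : Language.pv.BoundedFormula Empty (n + 2) := tblMatrix true ψ₁ s T₁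
  have hM : M.IsQF := isQF_tblMatrix true hψ₁ s T₁
  let G : PVFun (n + 2) := charSym M
  refine ⟨searchEq G s, tblBound s T₁, (IsAtomic.equal _ _).isQF, fun K _ _ _ hK xs W _ hW i hi => ?_,
    fun K _ _ _ hK hsat xs hall => ?_⟩
  · haveI : K ⊨ BASIC := model_BASIC_of_trueUnivPV hK
    rw [realize_searchEq] at hW
    set sv := s.realize (Sum.elim default xs) with hsv
    have h01 : ∀ z : K, papp G (Fin.snoc (Fin.snoc xs W) z) = 0 ∨ papp G (Fin.snoc (Fin.snoc xs W) z) = 1 :=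
      fun z => (papp_charSym hK hM _).2
    rw [mLe_iff] at hi
    have hGi := ((forall_le_len_iff hK G (Fin.snoc xs W) sv h01).2 hW) i hi
    rw [(papp_charSym hK hM _).1] at hGi
    obtain ⟨h1, h2⟩ := (realize_tblMatrix_true ψ₁ s T₁ xs W i).1 hGi
    exact s₁ K hK (Fin.snoc xs i) _ ((mLe_iff _ _).2 h1) h2
  · haveI : K ⊨ BASIC := model_BASIC_of_trueUnivPV hK
    set sv := s.realize (Sum.elim default xs) with hsv
    obtain ⟨W, hWle, hW⟩ := exists_table hK hsat hψ₁ s T₁ xs fun i hi => by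
      obtain ⟨w, hw, hψ⟩ := c₁ K hK hsat (Fin.snoc xs i) (hall i ((mLe_iff _ _).2 hi))
      exact ⟨w, (mLe_iff _ _).1 hw, hψ⟩
    refine ⟨W, ?_, ?_⟩
    · rw [mLe_iff, realize_tblBound]; exact hWle
    · rw [realize_searchEq]
      have h01 : ∀ z : K, papp G (Fin.snoc (Fin.snoc xs W) z) = 0 ∨ papp G (Fin.snoc (Fin.snoc xs W) z) = 1 :=
        fun z => (papp_charSym hK hM _).2
      refine (forall_le_len_iff hK G (Fin.snoc xs W) sv h01).1 fun i hi => ?_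
      rw [(papp_charSym hK hM _).1]
      exact (realize_tblMatrix_true ψ₁ s T₁ xs W i).2 (hW i hi)

/-- **`∃ i ≤ |s|` over `Π` is `Π`** (dual collection). [cite: Buss1986, §2.7] -/
theorem HasPiForm.bexLELen (s : Language.boundedArith.Term (Empty ⊕ Fin n)) {A : ModelPred (n + 1)}
    (hA : HasPiForm A) :
    HasPiForm fun K _ _ xs => ∃ i : K, MLe i (mLen (s.realize (Sum.elim default xs))) ∧ A K (Fin.snoc xs i) := by
  obtain ⟨ψ₁, T₁, hψ₁, s₁, c₁⟩ := hA
  let N : Language.pv.BoundedFormula Empty (n + 2) := tblMatrix false ψ₁ s T₁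
  have hN : N.IsQF := isQF_tblMatrix false hψ₁ s T₁
  let G : PVFun (n + 2) := charSym (∼N)
  refine ⟨∼(searchEq G s), tblBound s T₁, (IsAtomic.equal _ _).isQF.not, fun K _ _ _ hK xs hex W _ => ?_,
    fun K _ _ _ hK hsat xs hall => ?_⟩
  · haveI : K ⊨ BASIC := model_BASIC_of_trueUnivPV hK
    obtain ⟨i₀, hi₀, hAi₀⟩ := hex
    rw [mLe_iff] at hi₀
    rw [realize_not, realize_searchEq]
    set sv := s.realize (Sum.elim default xs) with hsv
    have h01 : ∀ z : K, papp G (Fin.snoc (Fin.snoc xs W) z) = 0 ∨ papp G (Fin.snoc (Fin.snoc xs W) z) = 1 :=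
      fun z => (papp_charSym hK hN.not _).2
    rw [← forall_le_len_iff hK G (Fin.snoc xs W) sv h01]
    intro hall
    have h := hall i₀ hi₀
    rw [(papp_charSym hK hN.not _).1, realize_not, realize_tblMatrix_false] at h
    exact h fun hle => s₁ K hK (Fin.snoc xs i₀) hAi₀ _ ((mLe_iff _ _).2 hle)
  · haveI : K ⊨ BASIC := model_BASIC_of_trueUnivPV hK
    set sv := s.realize (Sum.elim default xs) with hsv
    by_contra hcon
    push Not at hcon
    -- for every `i ≤ |s|`, a counter-witness below `T₁`
    have hcw : ∀ i : K, i ≤ mLen sv → ∃ w : K, w ≤ T₁.realize (Sum.elim default (Fin.snoc xs i)) ∧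
        (∼ψ₁).Realize default (Fin.snoc (Fin.snoc xs i) w) := by
      intro i hi
      by_contra h
      push Not at h
      refine hcon i ((mLe_iff _ _).2 hi) (c₁ K hK hsat (Fin.snoc xs i) fun w hw => ?_)
      have := h w ((mLe_iff _ _).1 hw)
      rwa [realize_not, not_not] at this
    obtain ⟨W, hWle, hW⟩ := exists_table hK hsat hψ₁.not s T₁ xs hcw
    have hΨ := hall W (by rw [mLe_iff, realize_tblBound]; exact hWle)
    rw [realize_not, realize_searchEq] at hΨ
    have h01 : ∀ z : K, papp G (Fin.snoc (Fin.snoc xs W) z) = 0 ∨ papp G (Fin.snoc (Fin.snoc xs W) z) = 1 :=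
      fun z => (papp_charSym hK hN.not _).2
    refine hΨ ((forall_le_len_iff hK G (Fin.snoc xs W) sv h01).1 fun i hi => ?_)
    rw [(papp_charSym hK hN.not _).1, realize_not, realize_tblMatrix_false]
    obtain ⟨h1, h2⟩ := hW i hi
    rw [realize_not] at h2
    exact fun h => h2 (h h1)

/-! ### The simultaneous induction over `Σᵇ₁ / Πᵇ₁` -/

/-- **Strict forms of `Σᵇ₁` and `Πᵇ₁` formulas** (and open forms of `Σᵇ₀ = Πᵇ₀` ones): every
`Σᵇ₁` formula of Buss's language has a strict `Σ` form and every `Πᵇ₁` formula a strict `Π` form,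
sound in all models of `trueUnivPV` and complete in the Herbrand-saturated ones — simultaneous
induction on the generation of the classes (Buss 1986, §2.7; Krajíček 1995, proof of
Thm. 7.6.3). [cite: Buss1986, §2.7] -/
theorem hasForms_of_isSigmab_of_isPib (i : ℕ) :
    (∀ {m : ℕ} {θ : Language.boundedArith.BoundedFormula Empty m}, IsSigmab i θ →
      (i = 0 → HasOpenForm (predOf θ)) ∧ (i = 1 → HasSigmaForm (predOf θ))) ∧
    (∀ {m : ℕ} {θ : Language.boundedArith.BoundedFormula Empty m}, IsPib i θ →
      (i = 0 → HasOpenForm (predOf θ)) ∧ (i = 1 → HasPiForm (predOf θ))) := by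
  constructor
  · intro m θ h
    refine IsSigmab.rec
      (motive_1 := fun i m θ _ => (i = 0 → HasOpenForm (predOf θ)) ∧ (i = 1 → HasSigmaForm (predOf θ)))
      (motive_2 := fun i m θ _ => (i = 0 → HasOpenForm (predOf θ)) ∧ (i = 1 → HasPiForm (predOf θ)))
      ?_ ?_ ?_ ?_ ?_ ?_ ?_ ?_ ?_ ?_ h
    all_goals intros
    · exact ⟨fun _ => hasOpenForm_of_isSharplyBounded ‹_›,
        fun _ => (hasOpenForm_of_isSharplyBounded ‹_›).hasSigmaForm⟩
    · rename_i i n φ hφ ih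
      exact ⟨fun h => absurd h (Nat.succ_ne_zero _), fun h => (ih.1 (by omega)).hasSigmaForm⟩
    · rename_i i n φ ψ hφ hψ ih₁ ih₂
      refine ⟨fun h => absurd h (Nat.succ_ne_zero _), fun h => ?_⟩
      exact ((ih₁.2 h).imp_sigma (ih₂.2 h)).of_iff fun K _ _ _ hK xs => by simp [predOf]
    · rename_i i n t φ hφ ih
      refine ⟨fun h => absurd h (Nat.succ_ne_zero _), fun h => ?_⟩
      exact ((ih.2 h).bexLE t).of_iff fun K _ _ _ hK xs => by simp [predOf]
    · rename_i i n t φ hφ ih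
      refine ⟨fun h => absurd h (Nat.succ_ne_zero _), fun h => ?_⟩
      exact ((ih.2 h).ballLELen t).of_iff fun K _ _ _ hK xs => by
        simp only [predOf, ballLELen, realize_ballLE', realize_term_len]
    · exact ⟨fun _ => hasOpenForm_of_isSharplyBounded ‹_›,
        fun _ => (hasOpenForm_of_isSharplyBounded ‹_›).hasPiForm⟩
    · rename_i i n φ hφ ih
      exact ⟨fun h => absurd h (Nat.succ_ne_zero _), fun h => (ih.1 (by omega)).hasPiForm⟩
    · rename_i i n φ ψ hφ hψ ih₁ ih₂
      refine ⟨fun h => absurd h (Nat.succ_ne_zero _), fun h => ?_⟩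
      exact ((ih₁.2 h).imp_pi (ih₂.2 h)).of_iff fun K _ _ _ hK xs => by simp [predOf]
    · rename_i i n t φ hφ ih
      refine ⟨fun h => absurd h (Nat.succ_ne_zero _), fun h => ?_⟩
      exact ((ih.2 h).ballLE t).of_iff fun K _ _ _ hK xs => by simp [predOf]
    · rename_i i n t φ hφ ih
      refine ⟨fun h => absurd h (Nat.succ_ne_zero _), fun h => ?_⟩
      exact ((ih.2 h).bexLELen t).of_iff fun K _ _ _ hK xs => by
        simp only [predOf, bexLELen, realize_bexLE', realize_term_len]
  · intro m θ h
    refine IsPib.rec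
      (motive_1 := fun i m θ _ => (i = 0 → HasOpenForm (predOf θ)) ∧ (i = 1 → HasSigmaForm (predOf θ)))
      (motive_2 := fun i m θ _ => (i = 0 → HasOpenForm (predOf θ)) ∧ (i = 1 → HasPiForm (predOf θ)))
      ?_ ?_ ?_ ?_ ?_ ?_ ?_ ?_ ?_ ?_ h
    all_goals intros
    · exact ⟨fun _ => hasOpenForm_of_isSharplyBounded ‹_›,
        fun _ => (hasOpenForm_of_isSharplyBounded ‹_›).hasSigmaForm⟩
    · rename_i i n φ hφ ih
      exact ⟨fun h => absurd h (Nat.succ_ne_zero _), fun h => (ih.1 (by omega)).hasSigmaForm⟩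
    · rename_i i n φ ψ hφ hψ ih₁ ih₂
      refine ⟨fun h => absurd h (Nat.succ_ne_zero _), fun h => ?_⟩
      exact ((ih₁.2 h).imp_sigma (ih₂.2 h)).of_iff fun K _ _ _ hK xs => by simp [predOf]
    · rename_i i n t φ hφ ih
      refine ⟨fun h => absurd h (Nat.succ_ne_zero _), fun h => ?_⟩
      exact ((ih.2 h).bexLE t).of_iff fun K _ _ _ hK xs => by simp [predOf]
    · rename_i i n t φ hφ ih
      refine ⟨fun h => absurd h (Nat.succ_ne_zero _), fun h => ?_⟩
      exact ((ih.2 h).ballLELen t).of_iff fun K _ _ _ hK xs => by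
        simp only [predOf, ballLELen, realize_ballLE', realize_term_len]
    · exact ⟨fun _ => hasOpenForm_of_isSharplyBounded ‹_›,
        fun _ => (hasOpenForm_of_isSharplyBounded ‹_›).hasPiForm⟩
    · rename_i i n φ hφ ih
      exact ⟨fun h => absurd h (Nat.succ_ne_zero _), fun h => (ih.1 (by omega)).hasPiForm⟩
    · rename_i i n φ ψ hφ hψ ih₁ ih₂
      refine ⟨fun h => absurd h (Nat.succ_ne_zero _), fun h => ?_⟩
      exact ((ih₁.2 h).imp_pi (ih₂.2 h)).of_iff fun K _ _ _ hK xs => by simp [predOf]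
    · rename_i i n t φ hφ ih
      refine ⟨fun h => absurd h (Nat.succ_ne_zero _), fun h => ?_⟩
      exact ((ih.2 h).ballLE t).of_iff fun K _ _ _ hK xs => by simp [predOf]
    · rename_i i n t φ hφ ih
      refine ⟨fun h => absurd h (Nat.succ_ne_zero _), fun h => ?_⟩
      exact ((ih.2 h).bexLELen t).of_iff fun K _ _ _ hK xs => by
        simp only [predOf, bexLELen, realize_bexLE', realize_term_len]

/-- **Every `Σᵇ₁` formula has a strict `Σ` form.** [cite: Buss1986, §2.7] -/
theorem hasSigmaForm_of_isSigmab_one {θ : Language.boundedArith.BoundedFormula Empty n}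
    (h : IsSigmab 1 θ) : HasSigmaForm (predOf θ) :=
  ((hasForms_of_isSigmab_of_isPib 1).1 h).2 rfl

/-- **Every `Πᵇ₁` formula has a strict `Π` form.** [cite: Buss1986, §2.7] -/
theorem hasPiForm_of_isPib_one {θ : Language.boundedArith.BoundedFormula Empty n}
    (h : IsPib 1 θ) : HasPiForm (predOf θ) :=
  ((hasForms_of_isSigmab_of_isPib 1).2 h).2 rfl

end Strict

end Literature.Analysis.FunctionSpaces
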